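import Summits.Parity.GeneralizedHardyLittlewood.Theorems.LiouvilleShiftedTablesSieveToMAvgDispatchI2

/-!
# Sieve glue for `SieveToMAvg`, part 9a: facts about a relevant box tuple

Support file for item stmt-Parity-14274 (route `LiouvilleShiftedTables`).  A tuple `κ` whose boxed
product `prodB κ` does not vanish identically on `(x, 2x]` is RELEVANT; then every slot's factor is
nonzero somewhere in its box, so `P_i ≥ 1/2`, the Möbius slots have `P_i < U`, and
`x/2^{2j} < ∏ P_i < 2x`.  In logarithmic form (`g_i = log P_i`, `L = log 2x`) these are exactly the
hypotheses of the classification of part 4.  We also record the conversion between partial sums of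
the `g_i` and products of the `P_i`, and a uniform form of the divisor power sum bounds.
-/

namespace Summit.Parity.GeneralizedHardyLittlewood.Theorems.SieveToMAvg

open Finset Real
open scoped ArithmeticFunction.zeta ArithmeticFunction.sigma
open Literature.NumberTheory.Sieve (abs_prod_apply_le_sigma_zero_pow one_le_sigma_zero)
open Literature.NumberTheory.Sieve.BFI

section Facts

variable {x : ℝ} {U j t : ℕ}

/-- In a Dirichlet product with a nonzero value, every factor has a nonzero value at some positive
integer. [folklore] -/
theorem exists_ne_zero_of_prod_ne_zero {ι : Type*} [DecidableEq ι] (s : Finset ι)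
    (f : ι → ArithmeticFunction ℝ) {n : ℕ} (hn : (∏ i ∈ s, f i) n ≠ 0) :
    ∀ i ∈ s, ∃ d : ℕ, 0 < d ∧ f i d ≠ 0 := by
  induction s using Finset.induction_on generalizing n with
  | empty => intro i hi; exact absurd hi (Finset.notMem_empty i)
  | @insert a s ha ih =>
    intro i hi
    rw [Finset.prod_insert ha, ArithmeticFunction.mul_apply] at hn
    obtain ⟨p, hp, hp0⟩ := Finset.exists_ne_zero_of_sum_ne_zero hn
    have hp1 : f a p.1 ≠ 0 := left_ne_zero_of_mul hp0
    have hp2 : (∏ k ∈ s, f k) p.2 ≠ 0 := right_ne_zero_of_mul hp0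
    rcases Finset.mem_insert.1 hi with rfl | hi'
    · refine ⟨p.1, Nat.pos_of_ne_zero ?_, hp1⟩
      intro h0; rw [h0, ArithmeticFunction.map_zero] at hp1; exact hp1 rfl
    · exact ih hp2 i hi'

/-- **Relevant tuples**: if `prodB κ (n) ≠ 0` for some `x < n ≤ 2x` (`x > 0`, `j ≥ 1`), then
`∀ i, 1/2 ≤ P_i`, the Möbius slots have `P_i < U`, and `x / 2^{2j} < ∏_i P_i < 2x`. [folklore] -/
theorem relevant_facts (hj : 1 ≤ j) (hx : 0 < x) (κ : Fin (2 * j) → ℕ) {n : ℕ} (hn1 : x < n)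
    (hn2 : (n : ℝ) ≤ 2 * x) (hne : prodB x U j t κ n ≠ 0) :
    (∀ i, 1 / 2 ≤ P x (κ i)) ∧ (∀ i : Fin (2 * j), (i : ℕ) < j → P x (κ i) < U) ∧
      x / 2 ^ (2 * j) < ∏ i, P x (κ i) ∧ ∏ i, P x (κ i) < 2 * x := by
  classical
  obtain ⟨hlo, hhi⟩ := prodB_ne_zero hj hx κ hne
  have hfac := exists_ne_zero_of_prod_ne_zero (Finset.univ : Finset (Fin (2 * j)))
    (fun i => bFactor x U j t i (κ i)) (by unfold prodB at hne; exact hne)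
  refine ⟨fun i => ?_, fun i hi => P_lt_of_prodB_ne_zero κ hne i hi, ?_, hlo.trans_le hn2⟩
  · obtain ⟨d, hd0, hd⟩ := hfac i (Finset.mem_univ i)
    obtain ⟨⟨_, _, h2⟩, -⟩ := bFactor_ne_zero hd
    have hd1 : (1 : ℝ) ≤ d := by exact_mod_cast hd0
    linarith
  · have hpow : (0 : ℝ) < 2 ^ (2 * j) := by positivity
    rw [div_lt_iff₀ hpow]
    calc x < n := hn1
      _ ≤ 2 ^ (2 * j) * ∏ i, P x (κ i) := hhi
      _ = (∏ i, P x (κ i)) * 2 ^ (2 * j) := mul_comm _ _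

/-- Partial sums of `log P_i` are logarithms of partial products (`x > 0`). [folklore] -/
theorem sum_log_P_eq (hx : 0 < x) (κ : Fin (2 * j) → ℕ) (S : Finset (Fin (2 * j))) :
    ∑ i ∈ S, Real.log (P x (κ i)) = Real.log (∏ i ∈ S, P x (κ i)) :=
  (Real.log_prod (s := S) (f := fun i => P x (κ i)) (fun i _ => (P_pos hx (κ i)).ne')).symm

/-- From `a L ≤ ∑_{i∈S} log P_i ≤ b L` (`L = log 2x`, `x > 0`) to `(2x)^a ≤ ∏_S P_i ≤ (2x)^b`. [folklore] -/
theorem window_of_log_window (hx : 0 < x) (κ : Fin (2 * j) → ℕ) {S : Finset (Fin (2 * j))} {a b : ℝ}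
    (h1 : a * Real.log (2 * x) ≤ ∑ i ∈ S, Real.log (P x (κ i)))
    (h2 : ∑ i ∈ S, Real.log (P x (κ i)) ≤ b * Real.log (2 * x)) :
    (2 * x) ^ a ≤ ∏ i ∈ S, P x (κ i) ∧ ∏ i ∈ S, P x (κ i) ≤ (2 * x) ^ b := by
  have hpos : 0 < ∏ i ∈ S, P x (κ i) := Finset.prod_pos fun i _ => P_pos hx (κ i)
  have h2x : 0 < 2 * x := by linarith
  rw [sum_log_P_eq hx κ S] at h1 h2
  constructor
  · rw [Real.rpow_def_of_pos h2x, ← Real.exp_log hpos]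
    exact Real.exp_le_exp.2 (by linarith)
  · rw [Real.rpow_def_of_pos h2x, ← Real.exp_log hpos]
    exact Real.exp_le_exp.2 (by linarith)

/-- From `∑_{i∈S} log P_i < a L` to `∏_S P_i < (2x)^a` (`x > 0`). [folklore] -/
theorem prod_lt_of_sum_log_lt (hx : 0 < x) (κ : Fin (2 * j) → ℕ) {S : Finset (Fin (2 * j))} {a : ℝ}
    (h1 : ∑ i ∈ S, Real.log (P x (κ i)) < a * Real.log (2 * x)) : ∏ i ∈ S, P x (κ i) < (2 * x) ^ a := by
  have hpos : 0 < ∏ i ∈ S, P x (κ i) := Finset.prod_pos fun i _ => P_pos hx (κ i)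
  have h2x : 0 < 2 * x := by linarith
  rw [sum_log_P_eq hx κ S] at h1
  rw [Real.rpow_def_of_pos h2x, ← Real.exp_log hpos]
  exact Real.exp_lt_exp.2 (by linarith)

/-- From `b L < log P_i` to `(2x)^b < P_i` (`x > 0`). [folklore] -/
theorem lt_P_of_lt_log (hx : 0 < x) {k : ℕ} {b : ℝ} (h1 : b * Real.log (2 * x) < Real.log (P x k)) :
    (2 * x) ^ b < P x k := by
  have h2x : 0 < 2 * x := by linarith
  rw [Real.rpow_def_of_pos h2x, ← Real.exp_log (P_pos hx k)]
  exact Real.exp_lt_exp.2 (by linarith)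

end Facts

/-! ### Uniform divisor power sum bounds -/

/-- **Uniform bound for `Dτ`**: for every `r` there is `Cτ ≥ 1` with `Dτ(r, Y) ≤ Cτ Y (1 + log Y)^{2^{r+1}}`
for all `Y ≥ 1`. [folklore] -/
theorem exists_Dtau_le (r : ℕ) : ∃ Cτ : ℝ, 1 ≤ Cτ ∧ ∀ Y : ℝ, 1 ≤ Y →
    Dtau r Y ≤ Cτ * Y * (1 + Real.log Y) ^ (2 ^ (r + 1)) := by
  obtain ⟨C, hC, hb⟩ := Literature.NumberTheory.Sieve.exists_sum_sigma_zero_pow_le_real r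
  refine ⟨max C 1, le_max_right _ _, fun Y hY => ?_⟩
  have hlog0 : 0 ≤ Real.log Y := Real.log_nonneg hY
  rcases lt_or_ge Y 2 with hY2 | hY2
  · -- `⌊Y⌋ = 1`
    have hfl : ⌊Y⌋₊ = 1 := by
      rw [Nat.floor_eq_iff (by linarith)]; norm_num; exact ⟨hY, hY2⟩
    unfold Dtau
    rw [hfl, Finset.Icc_self, Finset.sum_singleton, ArithmeticFunction.sigma_zero_apply, Nat.divisors_one,
      Finset.card_singleton, Nat.cast_one, one_pow]
    have h1 : (1 : ℝ) ≤ (1 + Real.log Y) ^ (2 ^ (r + 1)) := one_le_pow₀ (by linarith)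
    have h2 : (1 : ℝ) ≤ max C 1 * Y := by nlinarith [le_max_right C 1]
    nlinarith
  · unfold Dtau
    refine (hb Y hY2).trans ?_
    have h1 : Real.log Y ^ (2 ^ (r + 1)) ≤ (1 + Real.log Y) ^ (2 ^ (r + 1)) :=
      pow_le_pow_left₀ hlog0 (by linarith) _
    have h2 : C * Y ≤ max C 1 * Y := mul_le_mul_of_nonneg_right (le_max_left _ _) (by linarith)
    have h3 : 0 ≤ C * Y := by nlinarith
    calc C * Y * Real.log Y ^ (2 ^ (r + 1)) ≤ C * Y * (1 + Real.log Y) ^ (2 ^ (r + 1)) :=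
          mul_le_mul_of_nonneg_left h1 h3
      _ ≤ max C 1 * Y * (1 + Real.log Y) ^ (2 ^ (r + 1)) :=
          mul_le_mul_of_nonneg_right h2 (by positivity)

/-- Monotonicity of the uniform majorant in `Y` and in the logarithm: for `1 ≤ Y ≤ Z`,
`Cτ Y (1 + log Y)^e ≤ Cτ Y (1 + log Z)^e`. [folklore] -/
theorem majorant_mono {Cτ Y Z : ℝ} (hC : 0 ≤ Cτ) (hY : 1 ≤ Y) (hYZ : Y ≤ Z) (e : ℕ) :
    Cτ * Y * (1 + Real.log Y) ^ e ≤ Cτ * Y * (1 + Real.log Z) ^ e := by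
  have h1 : Real.log Y ≤ Real.log Z := Real.log_le_log (by linarith) hYZ
  have h0 : 0 ≤ Real.log Y := Real.log_nonneg hY
  exact mul_le_mul_of_nonneg_left (pow_le_pow_left₀ (by linarith) (by linarith) e) (by nlinarith)

end Summit.Parity.GeneralizedHardyLittlewood.Theorems.SieveToMAvg
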